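import Mathlib
import Summits.HodgeConjecture.FermatCycles.HodgeFermatHypVTailB

/-!
# HYPOTHESIS V beyond `30000` — part 3: the tail theorem `vTail` (`HodgeFermat/HypVTail.lean`; HF-G33)

Tree copy (part 3 of 3) of the module `HodgeFermat/HypVTail.lean` of the sibling cell's standalone package
`run/shared/lean/pub/pub-hodgefermat/lean/HodgeFermat/` (799 lines, sha256 `1145426fd717b34a…`), source lines 532–799 (§5 the tail: `dd`, list bookkeeping, `four_primes`, `eleven_le`, and `vTail : IneqV 46189 → VTail 30000`).
Filed by cell `pub-hfermat`, seat prover-1 gen-2, on the COORDINATOR KEEPER RULING of 2026-08-25 (gem sweep H1: take the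
off-gate kernel theorem `thmFstar` through the gate) — here its second namesake, `HodgeFermat/ThmFstarNFinal.lean:29`,
THEOREM F*(3N) at every admissible squarefree level (the first, `DecodingFinal.thmFstar` = THEOREM F* at the prime levels,
landed on 2026-08-25 as `HodgeFermatThmFstar.lean`, seat prover-1 gen-0); this file is one link of the import closure of
`ThmFstarNFinal.thmFstar` on top of that landed chain.  The source module's declarations are VERBATIM those of the cell record
`check/ThmFstarN_standalone.lean` (21 bodies, 438 871 B, sha256 ced731ec52c92191…, hub `lean check` rc 0, 222.2 s, `--axioms …ThmFstarN.thmFstarN` = [propext, Classical.choice, Quot.sound]; pub-hodgefermat `CERT.md` l.987, GATE HF-G33).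
Deviations from the source module, exhaustively: the `import` lines (tree modules `Summits.HodgeConjecture.FermatCycles.
HodgeFermat*` instead of `HodgeFermat.*`); this module docstring; the `set_option`/namespace/`open` preamble (source l.31–35) is repeated at the top because the module is split; one-line docstrings added (gate lint) to `list_sum_map_range`, `list_prod_map_range`, `list_eq_of_length_four`. The module docstring is quoted in full in part 1.  Cell record of the whole module: `check/HypVTail_standalone.lean` (2 bodies, 64 343 B, sha256 `17a27ced9ca48a43…`, hub `lean check` rc 0, 36.1 s, `--axioms …HypVTail.vTail` = the trio).
Every other line — in particular every declaration's statement and proof — is byte-identical to the source.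
HONEST FRAMING: explicit algebraic cycles for specific Hodge classes on Fermat/Delsarte varieties; residual open instances
listed; no claim on general Hodge.  (This file is arithmetic of CM types / of `(ℤ/N)ˣ`; it claims nothing about cycles.)
-/

set_option autoImplicit false

namespace HodgeFermat.KRFree.HypVTail

open Finset HodgeFermat.KRFree.HypVDefs
/-! ## §5 The tail -/

/-- the exponent floor used for the prime factor `p` of `N` (`S = N.primeFactors`, `k = #S`). -/
def dd (k : ℕ) (S : Finset ℕ) (p : ℕ) : ℕ := max (E k p) (S.filter (fun q => p ≤ q)).card

/-- a `List.map` sum as a sum over `range l.length` -/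
theorem list_sum_map_range (l : List ℕ) (g : ℕ → ℝ) :
    (l.map g).sum = ∑ i ∈ range l.length, g (l.getD i 0) := by
  induction l with
  | nil => simp
  | cons x l ih =>
      rw [List.map_cons, List.sum_cons, List.length_cons, Finset.sum_range_succ']
      simp only [List.getD_cons_succ, List.getD_cons_zero]
      rw [ih]; ring

/-- a `List.map` product as a product over `range l.length` -/
theorem list_prod_map_range (l : List ℕ) (g : ℕ → ℕ) :
    (l.map g).prod = ∏ i ∈ range l.length, g (l.getD i 0) := by
  induction l with
  | nil => simp
  | cons x l ih =>
      rw [List.map_cons, List.prod_cons, List.length_cons, Finset.prod_range_succ']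
      simp only [List.getD_cons_succ, List.getD_cons_zero]
      rw [ih, mul_comm]

/-- a list of length four is the list of its four entries -/
theorem list_eq_of_length_four (l : List ℕ) (h : l.length = 4) :
    l = [l.getD 0 0, l.getD 1 0, l.getD 2 0, l.getD 3 0] := by
  match l, h with
  | [a, b, c, d], _ => rfl

/-- the only four primes `11 ≤ p₀ < p₁ < p₂ < p₃ < 23` above the rank table are `11, 13, 17, 19` -/
theorem four_primes (p0 p1 p2 p3 : ℕ) (e0 : 11 ≤ p0) (e1 : 13 ≤ p1) (e2 : 17 ≤ p2) (e3 : 19 ≤ p3) (h3 : p3 < 23)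
    (m01 : p0 < p1) (m12 : p1 < p2) (m23 : p2 < p3) (o0 : p0 % 2 = 1) (o1 : p1 % 2 = 1) (o2 : p2 % 2 = 1)
    (o3 : p3 % 2 = 1) (t3 : ¬ 3 ∣ p3) (f1 : ¬ 5 ∣ p1) : p0 = 11 ∧ p1 = 13 ∧ p2 = 17 ∧ p3 = 19 := by
  -- one prime at a time (Lean's `omega` lacks the dark shadow: keep each problem ground)
  have v3 : p3 = 19 := by
    clear o0 o1 o2 f1 m01 m12 e0 e1 e2
    interval_cases p3 <;> omega
  subst v3
  have v2 : p2 = 17 := by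
    clear o0 o1 f1 m01 e0 e1 t3 o3
    interval_cases p2 <;> omega
  subst v2
  have v1 : p1 = 13 := by
    clear o0 e0 t3 o3 o2
    interval_cases p1 <;> omega
  subst v1
  have v0 : p0 = 11 := by
    clear t3 o3 o2 o1 f1
    interval_cases p0 <;> omega
  exact ⟨v0, rfl, rfl, rfl⟩

/-- a prime factor of a number prime to `210` is `≥ 11` -/
theorem eleven_le {p : ℕ} (hp : p.Prime) (h2 : ¬ 2 ∣ p) (h3 : ¬ 3 ∣ p) (h5 : ¬ 5 ∣ p) (h7 : ¬ 7 ∣ p) :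
    11 ≤ p := by
  by_contra h
  push Not at h
  have h2' := hp.two_le
  interval_cases p <;> omega

/-- **The tail of HYPOTHESIS V**: `IneqV N` for every squarefree `N > 30000` prime to `210`, given the level `46189`. -/
theorem vTail (h46189 : IneqV 46189) : VTail 30000 := by
  intro N hN hsq h2 h3 h5 h7
  have hN0 : N ≠ 0 := by omega
  set S := N.primeFactors with hS
  have hprod : ∏ q ∈ S, q = N := Nat.prod_primeFactors_of_squarefree hsq
  have hmemS : ∀ p ∈ S, p.Prime ∧ p ∣ N := fun p hp =>
    ⟨Nat.prime_of_mem_primeFactors hp, Nat.dvd_of_mem_primeFactors hp⟩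
  have hge11 : ∀ p ∈ S, 11 ≤ p ∧ p % 2 = 1 ∧ ¬ 3 ∣ p ∧ ¬ 5 ∣ p := by
    intro p hp
    obtain ⟨hpr, hdvd⟩ := hmemS p hp
    have hp2 : ¬ 2 ∣ p := fun h => h2 (dvd_trans h hdvd)
    have hp3 : ¬ 3 ∣ p := fun h => h3 (dvd_trans h hdvd)
    have hp5 : ¬ 5 ∣ p := fun h => h5 (dvd_trans h hdvd)
    have hp7 : ¬ 7 ∣ p := fun h => h7 (dvd_trans h hdvd)
    exact ⟨eleven_le hpr hp2 hp3 hp5 hp7, by omega, hp3, hp5⟩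
  have hcop : ∀ p ∈ S, Nat.Coprime p (N / p) := by
    intro p hp
    obtain ⟨hpr, hdvd⟩ := hmemS p hp
    rw [Nat.Prime.coprime_iff_not_dvd hpr]
    intro hdiv
    have hpp : p * p ∣ N := by
      have := Nat.mul_dvd_mul_left p hdiv
      rwa [Nat.mul_div_cancel' hdvd] at this
    have hu := hsq p hpp
    rw [Nat.isUnit_iff] at hu
    exact absurd hu hpr.one_lt.ne'
  have htot : ∀ p ∈ S, (N.totient : ℝ) = ((p : ℝ) - 1) * ((N / p).totient : ℝ) := by
    intro p hp
    obtain ⟨hpr, hdvd⟩ := hmemS p hp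
    have h := Nat.totient_mul (hcop p hp)
    rw [Nat.mul_div_cancel' hdvd, Nat.totient_prime hpr] at h
    rw [h]; push_cast [Nat.cast_sub hpr.one_lt.le]; ring
  have htotS : N.totient = ∏ p ∈ S, (p - 1) := by
    have h := Nat.totient_mul_prod_primeFactors N
    rw [← hS, hprod, mul_comm] at h
    exact Nat.eq_of_mul_eq_mul_left (Nat.pos_of_ne_zero hN0) h
  have hbN : ∀ p ∈ S, p ^ (S.filter (fun q => p ≤ q)).card ≤ N := by
    intro p hp
    calc p ^ (S.filter (fun q => p ≤ q)).card ≤ ∏ q ∈ S.filter (fun q => p ≤ q), q :=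
          Finset.pow_card_le_prod _ _ _ (fun q hq => (Finset.mem_filter.mp hq).2)
      _ ≤ ∏ q ∈ S, q := Finset.prod_le_prod_of_subset_of_one_le' (Finset.filter_subset _ _)
          (fun q hq _ => (hmemS q hq).1.one_lt.le)
      _ = N := hprod
  -- reindexing by rank
  set l := S.sort (fun a b => a ≤ b) with hl
  set k := l.length with hk
  have hkS : k = S.card := by rw [hk, hl, Finset.length_sort]
  have hSne : S.Nonempty := Nat.nonempty_primeFactors.mpr (by omega)
  have hk0 : 0 < k := by rw [hkS]; exact Finset.card_pos.mpr hSne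
  have hgetD : ∀ i, (hi : i < k) → l.getD i 0 = l.get ⟨i, by omega⟩ := by
    intro i hi
    rw [List.getD_eq_getElem l 0 hi]; rfl
  have hmem : ∀ i, i < k → l.getD i 0 ∈ S := by
    intro i hi
    rw [hgetD i hi]
    exact (Finset.mem_sort (fun a b => a ≤ b)).mp (List.get_mem l _)
  have hmono : ∀ i j, i < j → j < k → l.getD i 0 < l.getD j 0 := by
    intro i j hij hjk
    have hsm : StrictMono l.get := Finset.sortedLT_sort S
    rw [hgetD i (by omega), hgetD j hjk]
    exact hsm (show (⟨i, by omega⟩ : Fin l.length) < ⟨j, by omega⟩ from hij)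
  have hperm : l.Perm S.toList := Finset.sort_perm_toList S (fun a b => a ≤ b)
  have hlprod : l.prod = N := by
    rw [hperm.prod_eq, Finset.prod_toList, hprod]
  have hpf : ∀ i, i < k → qt i ≤ l.getD i 0 := by
    intro i
    induction i with
    | zero => intro h0; have := (hge11 _ (hmem 0 h0)).1; unfold qt qtab; simpa using this
    | succ i ih =>
        intro hi
        exact qt_step i _ _ (ih (by omega)) (hmono i (i + 1) (by omega) hi)
          (hge11 _ (hmem i (by omega))).2.1 (hge11 _ (hmem (i + 1) hi)).2.1 (hmemS _ (hmem (i + 1) hi)).1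
  -- a prime level
  by_cases hk1 : k = 1
  · obtain ⟨p, hSp⟩ := Finset.card_eq_one.mp (hkS ▸ hk1)
    have hpN : p = N := by rw [← hprod, hSp, Finset.prod_singleton]
    have hpr : N.Prime := hpN ▸ (hmemS p (by rw [hSp]; simp)).1
    unfold IneqV
    rw [← hS, hSp, Finset.sum_singleton, hpN, Nat.totient_prime hpr]
    have ht : tauV N N ≤ (N / N).totient := Nat.div_le_self _ _
    rw [Nat.div_self (by omega), Nat.totient_one] at ht
    omega
  have hk2 : 2 ≤ k := by omega
  -- the exceptional shape `k = 4`, `p_3 < 23`: `N = 46189`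
  by_cases h4 : k = 4 ∧ l.getD 3 0 < 23
  · obtain ⟨hk4, hp3⟩ := h4
    have e0 := hpf 0 (by omega); have e1 := hpf 1 (by omega); have e2 := hpf 2 (by omega); have e3 := hpf 3 (by omega)
    have m01 := hmono 0 1 (by omega) (by omega); have m12 := hmono 1 2 (by omega) (by omega)
    have m23 := hmono 2 3 (by omega) (by omega)
    have g0 := hge11 _ (hmem 0 (by omega)); have g1 := hge11 _ (hmem 1 (by omega))
    have g2 := hge11 _ (hmem 2 (by omega)); have g3 := hge11 _ (hmem 3 (by omega))
    have q0 : qt 0 = 11 := by decide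
    have q1 : qt 1 = 13 := by decide
    have q2 : qt 2 = 17 := by decide
    have q3 : qt 3 = 19 := by decide
    rw [q0] at e0; rw [q1] at e1; rw [q2] at e2; rw [q3] at e3
    obtain ⟨v0, v1, v2, v3⟩ := four_primes _ _ _ _ e0 e1 e2 e3 hp3 m01 m12 m23 g0.2.1 g1.2.1 g2.2.1 g3.2.1
      g3.2.2.1 g1.2.2.2
    have hl4 := list_eq_of_length_four l (by omega)
    rw [v0, v1, v2, v3] at hl4
    have hN46189 : N = 46189 := by rw [← hlprod, hl4]; norm_num
    rw [hN46189]
    exact h46189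
  -- the general case
  have hp : ∀ i, i < k → lb k i ≤ l.getD i 0 := by
    intro i hi
    unfold lb
    split_ifs with h43
    · have : ¬ l.getD 3 0 < 23 := fun h' => h4 ⟨h43.1, h'⟩
      rw [h43.2]; omega
    · exact hpf i hi
  have hXN : X k ≤ N := by
    unfold X
    refine max_le hN.le ?_
    rw [← prod_range_eq_list]
    calc ∏ i ∈ range (min k 50), qt i ≤ ∏ i ∈ range (min k 50), l.getD i 0 :=
          Finset.prod_le_prod (fun i _ => Nat.zero_le _)
            (fun i hi => hpf i (lt_of_lt_of_le (mem_range.mp hi) (min_le_left _ _)))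
      _ ≤ ∏ i ∈ range k, l.getD i 0 :=
          Finset.prod_le_prod_of_subset_of_one_le' (Finset.range_mono (min_le_left _ _))
            (fun i hi _ => by have := (hge11 _ (hmem i (mem_range.mp hi))).1; omega)
      _ = (l.map id).prod := by rw [list_prod_map_range]; rfl
      _ = N := by rw [List.map_id, hlprod]
  have hdpos : ∀ p ∈ S, 0 < dd k S p := by
    intro p hp
    have : 0 < (S.filter (fun q => p ≤ q)).card :=
      Finset.card_pos.mpr ⟨p, Finset.mem_filter.mpr ⟨hp, le_rfl⟩⟩
    exact lt_of_lt_of_le this (le_max_right _ _)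
  have hdo : ∀ p ∈ S, dd k S p ≤ orderOf ((p : ℕ) : ZMod (N / p)) := by
    intro p hp
    obtain ⟨hpr, hdvd⟩ := hmemS p hp
    have hm0 : 0 < N / p := Nat.div_pos (Nat.le_of_dvd (by omega) hdvd) hpr.pos
    have h1 := log_le_orderOf p (N / p) hpr (hcop p hp) hm0
    rw [Nat.mul_div_cancel' hdvd] at h1
    refine le_trans (max_le ?_ ?_) h1
    · exact Nat.log_mono_right hXN
    · exact Nat.le_log_of_pow_le hpr.one_lt (hbN p hp)
  -- one term
  have hterm : ∀ p ∈ S, (12 : ℝ) * (tauV N p : ℝ) ≤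
      (N.totient : ℝ) * (12 / ((((p - 1 : ℕ) : ℝ)) * (dd k S p : ℝ))) := by
    intro p hp
    obtain ⟨hpr, hdvd⟩ := hmemS p hp
    have ht := tauV_le N p (dd k S p) (hdpos p hp) (hdo p hp)
    have hp1 : (0 : ℝ) < (p : ℝ) - 1 := by
      have : (2 : ℝ) ≤ p := by exact_mod_cast hpr.two_le
      linarith
    have hdp : (0 : ℝ) < (dd k S p : ℝ) := by exact_mod_cast hdpos p hp
    rw [htot p hp, Nat.cast_sub hpr.one_lt.le, Nat.cast_one]
    have e : ((p : ℝ) - 1) * ((N / p).totient : ℝ) * (12 / (((p : ℝ) - 1) * (dd k S p : ℝ))) =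
        12 * (((N / p).totient : ℝ) / (dd k S p : ℝ)) := by
      field_simp
    rw [e]
    linarith
  have hcard : ∀ i, i < k → k - i ≤ (S.filter (fun q => l.getD i 0 ≤ q)).card := by
    intro i hi
    rw [← Nat.card_Ico i k]
    apply Finset.card_le_card_of_injOn (fun j => l.getD j 0)
    · intro j hj
      have hj' := Finset.mem_Ico.mp (Finset.mem_coe.mp hj)
      refine Finset.mem_coe.mpr (Finset.mem_filter.mpr ⟨hmem j hj'.2, ?_⟩)
      rcases Nat.eq_or_lt_of_le hj'.1 with h | h
      · rw [h]
      · exact (hmono i j h hj'.2).le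
    · intro j₁ hj₁ j₂ hj₂ heq
      have h1 := (Finset.mem_Ico.mp (Finset.mem_coe.mp hj₁)).2
      have h2 := (Finset.mem_Ico.mp (Finset.mem_coe.mp hj₂)).2
      rcases lt_trichotomy j₁ j₂ with h | h | h
      · exact absurd heq (ne_of_lt (hmono _ _ h h2))
      · exact h
      · exact absurd heq.symm (ne_of_lt (hmono _ _ h h1))
  have hkey := key k hk2 (fun i => l.getD i 0) (fun i => dd k S (l.getD i 0))
    (fun i hi => (hmemS _ (hmem i hi)).1) hp
    (fun i _ => le_max_left _ _) (fun i hi => le_trans (hcard i hi) (le_max_right _ _))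
  have hsum : ∑ p ∈ S, (12 : ℝ) / ((((p - 1 : ℕ) : ℝ)) * (dd k S p : ℝ)) =
      ∑ i ∈ range k, (12 : ℝ) / ((((l.getD i 0 - 1 : ℕ) : ℝ)) * (dd k S (l.getD i 0) : ℝ)) := by
    have h1 : ∑ p ∈ S, (12 : ℝ) / ((((p - 1 : ℕ) : ℝ)) * (dd k S p : ℝ)) =
        (l.map (fun p => (12 : ℝ) / ((((p - 1 : ℕ) : ℝ)) * (dd k S p : ℝ)))).sum := by
      rw [← Finset.sum_map_toList S]
      exact (List.Perm.map _ hperm).sum_eq.symm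
    rw [h1, list_sum_map_range]
  rw [← hsum] at hkey
  -- `Φ_k ≤ φ(N)`
  have hPhiN : Phi k ≤ N.totient := by
    rw [Phi_eq, htotS]
    calc ∏ i ∈ range k, (lb k i - 1) ≤ ∏ i ∈ range k, (l.getD i 0 - 1) :=
          Finset.prod_le_prod (fun i _ => Nat.zero_le _) (fun i hi => Nat.sub_le_sub_right (hp i (mem_range.mp hi)) 1)
      _ = (l.map (fun p => p - 1)).prod := by rw [list_prod_map_range]
      _ = ∏ p ∈ S, (p - 1) := by rw [(List.Perm.map _ hperm).prod_eq, Finset.prod_map_toList]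
  have hPhipos : 0 < Phi k := lt_of_lt_of_le (by norm_num) (le_Phi k hk2)
  have htotpos : (0 : ℝ) < (N.totient : ℝ) := by
    exact_mod_cast Nat.totient_pos.mpr (by omega)
  have h12 : (12 : ℝ) ≤ (N.totient : ℝ) * (12 / (Phi k : ℝ)) := by
    have hP : (0 : ℝ) < (Phi k : ℝ) := by exact_mod_cast hPhipos
    have hle : (Phi k : ℝ) ≤ (N.totient : ℝ) := by exact_mod_cast hPhiN
    rw [mul_div_assoc', le_div_iff₀ hP]
    nlinarith
  have hfinal : (12 : ℝ) + 12 * ∑ p ∈ S, (tauV N p : ℝ) < (N.totient : ℝ) := by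
    calc (12 : ℝ) + 12 * ∑ p ∈ S, (tauV N p : ℝ)
        = 12 + ∑ p ∈ S, 12 * (tauV N p : ℝ) := by rw [mul_sum]
      _ ≤ (N.totient : ℝ) * (12 / (Phi k : ℝ))
          + ∑ p ∈ S, (N.totient : ℝ) * (12 / ((((p - 1 : ℕ) : ℝ)) * (dd k S p : ℝ))) :=
          add_le_add h12 (sum_le_sum hterm)
      _ = (N.totient : ℝ) * (12 / (Phi k : ℝ) + ∑ p ∈ S, (12 / ((((p - 1 : ℕ) : ℝ)) * (dd k S p : ℝ)))) := by
          rw [mul_add, ← mul_sum]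
      _ < (N.totient : ℝ) * 1 := mul_lt_mul_of_pos_left hkey htotpos
      _ = (N.totient : ℝ) := mul_one _
  exact_mod_cast hfinal

end HodgeFermat.KRFree.HypVTail
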